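import Summits.BirchSwinnertonDyer.BirchSwinnertonDyer.Theorems.ByReductionTypeAtTwoAdditiveKatoTransportPrintExactKeyGamma
import Summits.BirchSwinnertonDyer.BirchSwinnertonDyer.Theorems.ByReductionTypeAtTwoMultOddBranchFunctionalEquation
import HarnessLib

/-!
# Route ByReductionTypeAtTwo, crux `AdditivePotMultOverKAtTwo` (stmt-BirchSwinnertonDyer-22618; parent
# `AdditiveRankZeroAtTwo` 19098) — T20 (d) IN THE KERNEL, part 3: the key-`γ` door FROM THE PRINT-EXACT input
# (addL2x GEN 16 `…AdditiveKatoTransportPrintExactKeyGamma`) with the functional-equation binder `hLtι` REMOVED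

Cell `bsd-2adic`, seat `bsd-2adic-t42` GEN 21 (AP3-R2, sequel of `ByReductionTypeAtTwoAdditiveOddBranchFEDoor`: the same
re-gluing for the fifth (−1)-block door, landed by addL2x after the first four). HONEST FRAMING (D-0036 / D-0054):
theorems only; types-the-object-of; closes none; nothing booked; BSD is not proved by any of this. PARTITION: X5@2
additive, C4″ 22618 (−1)-split-twist block × p = 2.

* `lengthAt_selmerDual_le_of_oddBranchInputsPrintExact_fe` — `AddKatoTwo.lengthAt_selmerDual_le_of_oddBranchInputsPrintExact`
  (key-`γ` conclusion from the key-`γ⁻¹` PRINT-EXACT typed input `KatoOddBranchInputsAtTwoNegOneSplitTwistPrintExact`) with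
  `hLtι` discharged by `MultOddBranchFE.map_invol_span_eq_of_eq_oddBranchMult_two_of_split hsp hf hLt` (Mazur–Tate–Teitelbaum
  §I.17 for the odd branch at a split multiplicative `2`, PROVED: p685202 / p686033).

References: [MazurTateTeitelbaum1986Invent] §I.17; [Kato2004Asterisque] Thm. 12.4, 12.5 (3), §17.13; [GreenbergLNM1716]
Thm. 1.14; [Greenberg1989] pp. 101–102; memo `run/shared/lean/pub/bsd-2adic/t42/DESIGN-T42-ADDENDUM-25.md`.
-/

set_option autoImplicit false
-- the summit's namespace `Summit.BirchSwinnertonDyer.BirchSwinnertonDyer` (Sub = Summit) trips `dupNamespace`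
set_option linter.dupNamespace false

noncomputable section

open scoped Classical MatrixGroups ModularForm NumberField

open Field CongruenceSubgroup PowerSeries WeierstrassCurve IsDedekindDomain
  Literature.NumberTheory.EllipticCurves Literature.NumberTheory.EllipticCurves.ModularForms
  Literature.NumberTheory.EllipticCurves.Module

namespace Summit.BirchSwinnertonDyer.BirchSwinnertonDyer.Theorems.MultOddBranchFE

/-- **Key-`γ` door from the PRINT-EXACT input, with T20 (d) IN THE KERNEL**:
`AddKatoTwo.lengthAt_selmerDual_le_of_oddBranchInputsPrintExact` with the functional-equation binder `hLtι` REMOVED.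
Displayed inputs: `Kato2004.thm12_4` (PRINT), `KatoOddBranchInputsAtTwoNegOneSplitTwistPrintExact` (typed input, key `γ⁻¹`),
finite generation of `D.X`, `hXι : ι(char X) = char X` (T20 (a)), `L̃ = 2^m L⁻ ≠ 0`.
[cite: Kato2004Asterisque, Thm. 12.4 (2) (p. 221), Thm. 12.5 (3) and (12.5.1) (p. 222), §17.13 (pp. 279–280)]
[cite: MazurTateTeitelbaum1986Invent, §I.17] [cite: Greenberg1989, pp. 101–102] -/
theorem lengthAt_selmerDual_le_of_oddBranchInputsPrintExact_fe (h12 : Kato2004.thm12_4)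
    (hPE : AddKatoTwo.KatoOddBranchInputsAtTwoNegOneSplitTwistPrintExact)
    (W : WeierstrassCurve ℚ) [W.IsElliptic] [W.IsGloballyMinimal] [ContinuousSMul ℤ_[2] (W.tateModule 2)]
    {N : ℕ} [NeZero N] (f : CuspForm (Gamma0 N) 2) (κ : ZpExtension ℚ 2) (γ : absoluteGaloisGroup ℚ)
    (hsp : (W.quadraticTwist (-1)).HasSplitMultiplicativeReductionAtPrime 2)
    (hirr : W.HasIrreducibleModPGaloisRep 2) (hκ : κ.IsCyclotomic) (hγ : κ.IsTopGenerator γ)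
    (hγ' : IsCyclotomicVariable 2 γ) (hf : IsNewformOf (W.quadraticTwist (-1)) f)
    (I : Kato2004.IwasawaH1Data W 2 κ γ) (D : W.SelmerDualData κ γ) [Module.Finite (IwasawaAlgebra 2) D.X]
    (hXι : (charIdeal (IwasawaAlgebra 2) D.X).map (IwasawaAlgebra.invol 2).toRingHom =
      charIdeal (IwasawaAlgebra 2) D.X)
    (Lt : IwasawaAlgebra 2) (m : ℕ)
    (hLt : iwasawaToPowerSeries 2 Lt =
      PowerSeries.C ((2 : ℚ_[2]) ^ m) * padicLFunctionMinusBranchMult f (1 : ℚ_[2]) 1)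
    (hLt0 : Lt ≠ 0)
    (𝔮 : PrimeSpectrum (IwasawaAlgebra 2)) (h𝔮 : 𝔮.asIdeal.height = 1)
    (hp𝔮 : PowerSeries.C (2 : ℤ_[2]) ∉ 𝔮.asIdeal) :
    lengthAt (IwasawaAlgebra 2) D.X 𝔮 ≤
      lengthAt (IwasawaAlgebra 2) (IwasawaAlgebra 2 ⧸ Ideal.span {Lt}) 𝔮 :=
  AddKatoTwo.lengthAt_selmerDual_le_of_oddBranchInputsPrintExact h12 hPE W f κ γ hsp hirr hκ hγ hγ' hf I D hXι
    Lt m hLt hLt0 (map_invol_span_eq_of_eq_oddBranchMult_two_of_split hsp hf hLt) 𝔮 h𝔮 hp𝔮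

end Summit.BirchSwinnertonDyer.BirchSwinnertonDyer.Theorems.MultOddBranchFE

end
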